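import Literature.Computability.AlgebraicComplexity.GlobalStagePresent
import Literature.Computability.AlgebraicComplexity.IndependentBlocks
import Literature.Computability.AlgebraicComplexity.LevelTriples
import HarnessLib

/-!
# The structure of `𝒯'''`: after the compatibility and usefulness zero-outs the tensor is a direct
sum, over the present block triples, of broken copies of `𝒯*`
(Vassilevska Williams–Xu–Xu–Zhou 2024, §5.3–§5.5: Claim 5.9, Claim 5.11, eq. `𝒯''' = ⊕ 𝒯'''|_{X_I Y_J Z_K}`) — proved

Topic `Literature/Computability/AlgebraicComplexity`.  This file assembles the deterministic
(structural) half of the global stage of Vassilevska Williams–Xu–Xu–Zhou, *New bounds for matrix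
multiplication: from alpha to omega* (SODA 2024, arXiv:2307.07970), §5.3–§5.5, from the landed
pieces: the block triples `𝒯'` present after hashing and cleanup (`GlobalStagePresent.lean`), the
position classes, usefulness and compatibility and Claim 5.9 (`LevelTriples.lean`), and the
direct-sum criterion (`IndependentBlocks.lean`).  Fix the data of one region (`GlobalStageData`:
marginal types `μ`, the distribution `α`, the complete split distributions `γ_X, γ_Y, γ_Z`, the
`α`-consistent triples `𝒯α`, the seed `ω` and the Salem–Spencer set `B`).  The level-1 blocks kept
by §5.3–§5.5 are (`keepX`, `keepY`, `keepZ`):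

* `X_Î` (resp. `Y_Ĵ`): its level-`ℓ` block `X_I` lies in a PRESENT triple `X_I Y_J Z_K` (unique,
  `presentTriples_eq_of_fst_eq`) and `Î` is useful for it — the compatibility zero-out I ("zero out
  `X_Î` if `split(Î, S_{i,j,k}) ≠ γ_{X,i,j,k}` for any `i,j,k`", w.r.t. the unique triple of `X_I`);
* `Z_K̂`: `Z_K` is kept and there is a present triple `X_I Y_J Z_K` for which `K̂` is useful and which
  is the ONLY present triple through `Z_K` compatible with `K̂` — the compatibility zero-outs I
  (typicalness; implied by usefulness, `IsUsefulFor.isTypical`), II ("zero out level-1 `Z`-blocks that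
  are compatible with more than one level-`ℓ` triples") and the usefulness zero-out.

(Level-1 blocks of kept level-`ℓ` blocks lying in NO present triple, resp. compatible with no present
triple, carry only zero entries after `𝒯'`; zeroing them as well, as these predicates do, does not
change the tensor — `finalTensor` below is the printed `𝒯'''`.)  With `finalTensor` the resulting
zero-out of `(CW_q^{⊗c})^{⊗n}` this file PROVES:

* `respectsAssignment` — **level-1-independence** (§5.5: "`X_I` and `Y_J` are already in unique
  level-`ℓ` triples in `𝒯'` … every remaining `Z_K̂` … is contained in a unique level-`ℓ` triple as
  well"): assigning each kept level-1 block to its present triple (`assignX/Y/Z`), every non-zero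
  entry has its three blocks in ONE triple — by the uniqueness of present triples through a kept
  `X`- or `Y`-block and **Claim 5.9** (`compatible_fst_of_useful`: `K̂` is compatible with the triple of
  `Î, Ĵ`, under Remark 5.2's convention on `γ_Z`);
* `finalTensor_restrictsTo_directSum` / `directSum_restrictsTo_finalTensor` — **`𝒯''' ≅ ⊕_{T present} 𝒯'''|_{X_I Y_J Z_K}`**
  (restrictions both ways, `IndependentBlocks.lean`);
* `summand_eq_brokenCopy` — **Claim 5.11**: the summand of the present triple `T = X_I Y_J Z_K` is
  the useful sub-tensor `𝒯*_T` (`usefulSubtensor`, = the interface tensor `𝒯*` up to relabelling,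
  `InterfaceRelabel.lean`) with exactly the level-1 `Z`-blocks useful for `T` but compatible with
  another present triple through `Z_K` zeroed out (`holes T`): a broken copy of `𝒯*` with holes in
  the `Z`-dimension only.

Everything is proved; the definitions are the zero-out predicates and the assignment; no named facts.

## References

* V. Vassilevska Williams, Y. Xu, Z. Xu, R. Zhou, *New bounds for matrix multiplication: from alpha
  to omega*, SODA 2024, arXiv:2307.07970 (held: `paper:arxiv-2307.07970`): §5.3 (compatibility
  zero-out I, Claim 5.9), §5.4 (zero-out II, holes), §5.5 (usefulness zero-out, Claim 5.11, the
  direct-sum decomposition), Remark 5.2. [VassilevskaWilliamsXuXuZhou2024]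
-/

noncomputable section

open scoped BigOperators
open Finset

namespace Literature.Computability.AlgebraicComplexity

open Literature.Barriers.MatrixMultiplication (bigCwTensor)

universe u

/-! ## Level-`ℓ` blocks as `Fin (2c+1)`-valued sequences -/

section Blocks

variable {c n : ℕ}

/-- The level-`ℓ` index sequence of a level-1 sequence, with values in `Fin (2c+1)` (chunk sums are
`≤ 2c`, `patternLevel_le`). [cite: VassilevskaWilliamsXuXuZhou2024, §3.8 (Î ∈ I)] -/
def blockOfSeq (Ih : Fin n → Fin c → Fin 3) : Fin n → Fin (2 * c + 1) :=
  fun t => ⟨patternLevel (Ih t), Nat.lt_succ_of_le (patternLevel_le _)⟩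

/-- Values of `blockOfSeq`. [folklore] -/
@[simp] theorem val_blockOfSeq (Ih : Fin n → Fin c → Fin 3) (t : Fin n) : (blockOfSeq Ih t : ℕ) = patternLevel (Ih t) := rfl

/-- `chunkLevels Î` is `blockOfSeq Î` read in `ℕ`. [folklore] -/
theorem chunkLevels_eq_seqVal_blockOfSeq (Ih : Fin n → Fin c → Fin 3) : chunkLevels Ih = seqVal (blockOfSeq Ih) := rfl

/-- `chunkLevels Î = I` (in `ℕ`) iff `blockOfSeq Î = I` (in `Fin (2c+1)`). [folklore] -/
theorem chunkLevels_eq_iff {Ih : Fin n → Fin c → Fin 3} {I : Fin n → Fin (2 * c + 1)} :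
    chunkLevels Ih = seqVal I ↔ blockOfSeq Ih = I := by
  constructor
  · intro h; funext t; exact Fin.ext (congrFun h t)
  · intro h; rw [← h]; rfl

end Blocks

/-! ## The data of one region of the global stage -/

/-- **The data of the first region of the global stage** (§5): the marginal types `μ_X, μ_Y, μ_Z`
(`= A₁ n · α_X`, …), the distribution `α` on constituent triples, the complete split distributions
`γ_{X,i,j,k}, γ_{Y,i,j,k}, γ_{Z,i,j,k}`, the set `𝒯α` of block triples consistent with `α` and the
Salem–Spencer set `B`; the seed `ω` of the hash functions is a separate argument throughout. [cite: VassilevskaWilliamsXuXuZhou2024, §5 (preamble) and §5.2] -/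
structure GlobalStageData (c n M : ℕ) where
  /-- marginal type of the `X`-blocks -/
  μX : Fin (2 * c + 1) → ℕ
  /-- marginal type of the `Y`-blocks -/
  μY : Fin (2 * c + 1) → ℕ
  /-- marginal type of the `Z`-blocks -/
  μZ : Fin (2 * c + 1) → ℕ
  /-- the distribution on constituent triples -/
  α : ℕ × ℕ × ℕ → ℝ
  /-- complete split distributions for the `X`-blocks of each constituent class -/
  γX : ℕ × ℕ × ℕ → (Fin c → Fin 3) → ℝ
  /-- complete split distributions for the `Y`-blocks of each constituent class -/
  γY : ℕ × ℕ × ℕ → (Fin c → Fin 3) → ℝ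
  /-- complete split distributions for the `Z`-blocks of each constituent class -/
  γZ : ℕ × ℕ × ℕ → (Fin c → Fin 3) → ℝ
  /-- the block triples consistent with `α` -/
  𝒯α : Finset ((Fin n → Fin (2 * c + 1)) × (Fin n → Fin (2 * c + 1)) × (Fin n → Fin (2 * c + 1)))
  /-- the Salem–Spencer set -/
  B : Finset (ZMod M)

namespace GlobalStageData

open scoped Classical

variable {c n M : ℕ} (D : GlobalStageData c n M)

/-- The block triples `𝒯` remaining after the zero-out by the marginals. [cite: VassilevskaWilliamsXuXuZhou2024, §5.2] -/
abbrev tripleSet : Finset ((Fin n → Fin (2 * c + 1)) × (Fin n → Fin (2 * c + 1)) × (Fin n → Fin (2 * c + 1))) :=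
  typedSupport (levelSupport (2 * c)) n D.μX D.μY D.μZ

/-- The block triples of `𝒯'` (present after hashing with seed `ω` and cleanup). [cite: VassilevskaWilliamsXuXuZhou2024, §5.2] -/
abbrev present (ω : VxxzSeed M n) :
    Finset ((Fin n → Fin (2 * c + 1)) × (Fin n → Fin (2 * c + 1)) × (Fin n → Fin (2 * c + 1))) :=
  presentTriples (2 * c) D.tripleSet D.𝒯α ω D.B

/-- Usefulness of a level-1 sequence for a block triple, `X`-data. [cite: VassilevskaWilliamsXuXuZhou2024, Def. 5.10 (and its X/Y analogues in §5.3)] -/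
abbrev UsefulX (T : (Fin n → Fin (2 * c + 1)) × (Fin n → Fin (2 * c + 1)) × (Fin n → Fin (2 * c + 1)))
    (Ih : Fin n → Fin c → Fin 3) : Prop :=
  IsUsefulFor D.γX (seqVal T.1) (seqVal T.2.1) (seqVal T.2.2) Ih

/-- Usefulness, `Y`-data. [cite: VassilevskaWilliamsXuXuZhou2024, §5.3] -/
abbrev UsefulY (T : (Fin n → Fin (2 * c + 1)) × (Fin n → Fin (2 * c + 1)) × (Fin n → Fin (2 * c + 1)))
    (Jh : Fin n → Fin c → Fin 3) : Prop :=
  IsUsefulFor D.γY (seqVal T.1) (seqVal T.2.1) (seqVal T.2.2) Jh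

/-- Usefulness, `Z`-data (Def. 5.10). [cite: VassilevskaWilliamsXuXuZhou2024, Def. 5.10] -/
abbrev UsefulZ (T : (Fin n → Fin (2 * c + 1)) × (Fin n → Fin (2 * c + 1)) × (Fin n → Fin (2 * c + 1)))
    (Kh : Fin n → Fin c → Fin 3) : Prop :=
  IsUsefulFor D.γZ (seqVal T.1) (seqVal T.2.1) (seqVal T.2.2) Kh

/-- Compatibility of a level-1 `Z`-sequence with a block triple (Def. 5.8). [cite: VassilevskaWilliamsXuXuZhou2024, Def. 5.8] -/
abbrev Compatible (T : (Fin n → Fin (2 * c + 1)) × (Fin n → Fin (2 * c + 1)) × (Fin n → Fin (2 * c + 1)))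
    (Kh : Fin n → Fin c → Fin 3) : Prop :=
  IsCompatibleWith c D.α D.γZ (seqVal T.1) (seqVal T.2.1) (seqVal T.2.2) Kh

/-! ### The level-1 blocks kept by the compatibility and usefulness zero-outs -/

/-- **`X_Î` is kept**: its level-`ℓ` block lies in a present triple for which `Î` is useful
(compatibility zero-out I for `X`). [cite: VassilevskaWilliamsXuXuZhou2024, §5.3 (compatibility zero-out I, X-blocks)] -/
def keepX (ω : VxxzSeed M n) (Ih : Fin n → Fin c → Fin 3) : Prop := ∃ T ∈ D.present ω, T.1 = blockOfSeq Ih ∧ D.UsefulX T Ih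

/-- **`Y_Ĵ` is kept** (compatibility zero-out I for `Y`). [cite: VassilevskaWilliamsXuXuZhou2024, §5.3] -/
def keepY (ω : VxxzSeed M n) (Jh : Fin n → Fin c → Fin 3) : Prop := ∃ T ∈ D.present ω, T.2.1 = blockOfSeq Jh ∧ D.UsefulY T Jh

/-- **`Z_K̂` is kept**: there is a present triple through `Z_K` for which `K̂` is useful and which is
the only present triple through `Z_K` compatible with `K̂` (compatibility zero-outs I–II and the
usefulness zero-out). [cite: VassilevskaWilliamsXuXuZhou2024, §5.3–§5.5] -/
def keepZ (ω : VxxzSeed M n) (Kh : Fin n → Fin c → Fin 3) : Prop :=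
  ∃ T ∈ D.present ω, T.2.2 = blockOfSeq Kh ∧ D.UsefulZ T Kh ∧
    ∀ T' ∈ D.present ω, T'.2.2 = blockOfSeq Kh → D.Compatible T' Kh → T' = T

/-- **The holes of the copy over the present triple `T`**: the level-1 `Z`-blocks useful for `T` that
are compatible with another present triple through `Z_K` (zeroed out in the unique-triple step).
[cite: VassilevskaWilliamsXuXuZhou2024, §5.4 and Claim 5.11 ("the missing variables … are exactly those in level-1 blocks Z_K̂ that are compatible with multiple level-ℓ triples")] -/
def holes (ω : VxxzSeed M n) (T : (Fin n → Fin (2 * c + 1)) × (Fin n → Fin (2 * c + 1)) × (Fin n → Fin (2 * c + 1))) :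
    Finset (Fin n → Fin c → Fin 3) := by
  classical
  exact univ.filter fun Kh => blockOfSeq Kh = T.2.2 ∧ D.UsefulZ T Kh ∧
    ∃ T' ∈ D.present ω, T' ≠ T ∧ T'.2.2 = T.2.2 ∧ D.Compatible T' Kh

variable (R : Type u) [CommSemiring R] (q : ℕ)

/-- **`𝒯'''`**: the zero-out of `(CW_q^{⊗c})^{⊗n}` keeping the level-1 blocks kept by §5.2–§5.5.
[cite: VassilevskaWilliamsXuXuZhou2024, §5.5 ("We call the current tensor 𝒯'''")] -/
def finalTensor (ω : VxxzSeed M n) :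
    (Fin n → Fin c → Fin (q + 2)) → (Fin n → Fin c → Fin (q + 2)) → (Fin n → Fin c → Fin (q + 2)) → R := by
  classical
  exact partSubtensor levelSeq levelSeq levelSeq (kroneckerPow (kroneckerPow (bigCwTensor R q) c) n)
    (univ.filter (D.keepX ω)) (univ.filter (D.keepY ω)) (univ.filter (D.keepZ ω))

/-! ### The assignment of the kept level-1 blocks to present triples -/

/-- The present triple of a kept level-1 `X`-block (`none` if not kept). [cite: VassilevskaWilliamsXuXuZhou2024, §5.5 (level-1-independence)] -/
def assignX (ω : VxxzSeed M n) (Ih : Fin n → Fin c → Fin 3) : Option ↥(D.present ω) := by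
  classical
  exact if h : D.keepX ω Ih then some ⟨h.choose, h.choose_spec.1⟩ else none

/-- The present triple of a kept level-1 `Y`-block. [cite: VassilevskaWilliamsXuXuZhou2024, §5.5] -/
def assignY (ω : VxxzSeed M n) (Jh : Fin n → Fin c → Fin 3) : Option ↥(D.present ω) := by
  classical
  exact if h : D.keepY ω Jh then some ⟨h.choose, h.choose_spec.1⟩ else none

/-- The present triple of a kept level-1 `Z`-block (the unique compatible one). [cite: VassilevskaWilliamsXuXuZhou2024, §5.4–§5.5] -/
def assignZ (ω : VxxzSeed M n) (Kh : Fin n → Fin c → Fin 3) : Option ↥(D.present ω) := by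
  classical
  exact if h : D.keepZ ω Kh then some ⟨h.choose, h.choose_spec.1⟩ else none

/-- `assignX Î = T` iff `X_Î` lies in `X_{T.1}` and `Î` is useful for the present triple `T` (the
present triple through a kept `X`-block is unique). [cite: VassilevskaWilliamsXuXuZhou2024, §5.5] -/
theorem assignX_eq_some_iff {ω : VxxzSeed M n} {Ih : Fin n → Fin c → Fin 3} {T : ↥(D.present ω)} :
    D.assignX ω Ih = some T ↔ T.1.1 = blockOfSeq Ih ∧ D.UsefulX T.1 Ih := by
  classical
  unfold assignX
  split_ifs with h
  · have hc := h.choose_spec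
    constructor
    · intro he
      have he' := Subtype.ext_iff.1 (Option.some_injective _ he)
      simp only at he'
      rw [← he']
      exact ⟨hc.2.1, hc.2.2⟩
    · rintro ⟨h1, hu⟩
      congr 1
      apply Subtype.ext
      exact presentTriples_eq_of_fst_eq hc.1 T.2 (hc.2.1.trans h1.symm)
  · constructor
    · intro he; exact absurd he (by simp)
    · rintro ⟨h1, hu⟩
      exact absurd ⟨T.1, T.2, h1, hu⟩ h

/-- `assignY Ĵ = T` iff `Y_Ĵ ⊆ Y_{T.2.1}` and `Ĵ` is useful for `T`. [cite: VassilevskaWilliamsXuXuZhou2024, §5.5] -/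
theorem assignY_eq_some_iff {ω : VxxzSeed M n} {Jh : Fin n → Fin c → Fin 3} {T : ↥(D.present ω)} :
    D.assignY ω Jh = some T ↔ T.1.2.1 = blockOfSeq Jh ∧ D.UsefulY T.1 Jh := by
  classical
  unfold assignY
  split_ifs with h
  · have hc := h.choose_spec
    constructor
    · intro he
      have he' := Subtype.ext_iff.1 (Option.some_injective _ he)
      simp only at he'
      rw [← he']
      exact ⟨hc.2.1, hc.2.2⟩
    · rintro ⟨h1, hu⟩
      congr 1
      apply Subtype.ext
      exact presentTriples_eq_of_snd_eq hc.1 T.2 (hc.2.1.trans h1.symm)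
  · constructor
    · intro he; exact absurd he (by simp)
    · rintro ⟨h1, hu⟩
      exact absurd ⟨T.1, T.2, h1, hu⟩ h

/-- **The standing hypotheses on the data** (§5 preamble, §5.2, Remark 5.2): `𝒯α ⊆ 𝒯` consists of
`α`-consistent triples, and the `Z`-split distributions of the classes with `j = 0`, resp. `i = 0`,
are the reversals of the `X`-, resp. `Y`-ones ("without loss of generality", Remark 5.2).
[cite: VassilevskaWilliamsXuXuZhou2024, §5.2 and Remark 5.2] -/
structure WellFormed : Prop where
  /-- the `α`-consistent triples are block triples with the marginal types -/
  subset : D.𝒯α ⊆ D.tripleSet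
  /-- … and are consistent with `α` -/
  alphaConsistent : ∀ T ∈ D.𝒯α, IsAlphaConsistent D.α (seqVal T.1) (seqVal T.2.1) (seqVal T.2.2)
  /-- Remark 5.2: `γ_{Z,i,0,k}(L) = γ_{X,i,0,k}(2⃗ − L)` -/
  revX : ∀ i k σ, D.γZ (i, 0, k) σ = D.γX (i, 0, k) (fun p => (σ p).rev)
  /-- Remark 5.2: `γ_{Z,0,j,k}(L) = γ_{Y,0,j,k}(2⃗ − L)` -/
  revY : ∀ j k σ, D.γZ (0, j, k) σ = D.γY (0, j, k) (fun p => (σ p).rev)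

variable {D}

/-- Triples of `𝒯` are block triples (`I + J + K = 2c`). [cite: VassilevskaWilliamsXuXuZhou2024, §5.2] -/
theorem isLevelTriple_of_mem_tripleSet
    {T : (Fin n → Fin (2 * c + 1)) × (Fin n → Fin (2 * c + 1)) × (Fin n → Fin (2 * c + 1))}
    (hT : T ∈ D.tripleSet) : IsLevelTriple c (seqVal T.1) (seqVal T.2.1) (seqVal T.2.2) :=
  fun t => levelSum_of_mem_typedSupport hT t

/-- Present triples are `α`-consistent block triples. [cite: VassilevskaWilliamsXuXuZhou2024, §5.2] -/
theorem present_good (hD : D.WellFormed) {ω : VxxzSeed M n}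
    {T : (Fin n → Fin (2 * c + 1)) × (Fin n → Fin (2 * c + 1)) × (Fin n → Fin (2 * c + 1))}
    (hT : T ∈ D.present ω) :
    IsLevelTriple c (seqVal T.1) (seqVal T.2.1) (seqVal T.2.2) ∧
      IsAlphaConsistent D.α (seqVal T.1) (seqVal T.2.1) (seqVal T.2.2) :=
  ⟨isLevelTriple_of_mem_tripleSet (hD.subset (presentTriples_subset hT)),
    hD.alphaConsistent T (presentTriples_subset hT)⟩

/-- `assignZ K̂ = T` iff `Z_K̂ ⊆ Z_{T.2.2}`, `K̂` is useful for `T`, and `T` is the only present triple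
through `Z_K` compatible with `K̂`. [cite: VassilevskaWilliamsXuXuZhou2024, §5.4–§5.5] -/
theorem assignZ_eq_some_iff (hD : D.WellFormed) {ω : VxxzSeed M n} {Kh : Fin n → Fin c → Fin 3}
    {T : ↥(D.present ω)} :
    D.assignZ ω Kh = some T ↔ T.1.2.2 = blockOfSeq Kh ∧ D.UsefulZ T.1 Kh ∧
      ∀ T' ∈ D.present ω, T'.2.2 = blockOfSeq Kh → D.Compatible T' Kh → T' = T.1 := by
  classical
  unfold assignZ
  split_ifs with h
  · have hc := h.choose_spec
    constructor
    · intro he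
      have he' := Subtype.ext_iff.1 (Option.some_injective _ he)
      simp only at he'
      rw [← he']
      exact ⟨hc.2.1, hc.2.2.1, hc.2.2.2⟩
    · rintro ⟨h1, hu, huniq⟩
      have hg := present_good hD hc.1
      have hcompat : D.Compatible h.choose Kh := IsUsefulFor.isCompatibleWith hg.1 hg.2 hc.2.2.1
      have heq : h.choose = T.1 := huniq _ hc.1 hc.2.1 hcompat
      congr 1
      exact Subtype.ext heq
  · constructor
    · intro he; exact absurd he (by simp)
    · rintro ⟨h1, hu, huniq⟩
      exact absurd ⟨T.1, T.2, h1, hu, huniq⟩ h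

/-! ### Level-1-independence (Claim 5.9 and the uniqueness of present triples) -/

/-- The level-`ℓ` blocks of a supported entry of the power form a triple of `𝒯` as soon as their types
are the marginal types. [cite: VassilevskaWilliamsXuXuZhou2024, §3.8 and §5.2] -/
theorem blockTriple_mem_tripleSet (R : Type u) [CommSemiring R] (q : ℕ) {x y z : Fin n → Fin c → Fin (q + 2)}
    (h : kroneckerPow (kroneckerPow (bigCwTensor R q) c) n x y z ≠ 0)
    (hx : letterCount (blockOfSeq (levelSeq x)) = D.μX) (hy : letterCount (blockOfSeq (levelSeq y)) = D.μY)
    (hz : letterCount (blockOfSeq (levelSeq z)) = D.μZ) :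
    (blockOfSeq (levelSeq x), blockOfSeq (levelSeq y), blockOfSeq (levelSeq z)) ∈ D.tripleSet := by
  rw [mem_typedSupport]
  refine ⟨hx, hy, hz, fun t => ?_⟩
  rw [mem_levelSupport]
  have := isLevelTriple_of_ne_zero R q h t
  simpa [chunkLevels_eq_seqVal_blockOfSeq] using this

/-- **Level-1-independence of `𝒯'''`** (§5.5): with the kept level-1 blocks assigned to their present
triples, every non-zero entry of the power all three of whose blocks are kept has them in ONE present
triple.  The `X`- and `Y`-blocks determine the triple by the cleanup; for the `Z`-block this is
**Claim 5.9** — `K̂` is compatible with the triple of `Î, Ĵ` (`compatible_fst_of_useful`, under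
Remark 5.2's convention) — together with its uniqueness recorded in `keepZ`.
[cite: VassilevskaWilliamsXuXuZhou2024, §5.5 ("𝒯'''|_{X_I Y_J Z_K} are level-1-independent") and Claim 5.9] -/
theorem respectsAssignment (hD : D.WellFormed) (R : Type u) [CommSemiring R] (q : ℕ) (ω : VxxzSeed M n) :
    RespectsAssignment levelSeq levelSeq levelSeq (kroneckerPow (kroneckerPow (bigCwTensor R q) c) n)
      (D.assignX ω) (D.assignY ω) (D.assignZ ω) := by
  intro x y z T₁ T₂ T₃ hne h1 h2 h3
  rw [assignX_eq_some_iff] at h1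
  rw [assignY_eq_some_iff] at h2
  rw [assignZ_eq_some_iff hD] at h3
  obtain ⟨hI, huX⟩ := h1
  obtain ⟨hJ, huY⟩ := h2
  obtain ⟨hK, huZ, huniq⟩ := h3
  -- the block triple `T₀ = (I, J, K)` of the entry is a hash-present triple of `𝒯`
  obtain ⟨hT₁𝒯, hT₁x, -, -⟩ := mem_presentTriples.1 T₁.2
  obtain ⟨hT₂𝒯, -, hT₂y, -⟩ := mem_presentTriples.1 T₂.2
  obtain ⟨hT₃𝒯, -, -, hT₃z⟩ := mem_presentTriples.1 T₃.2
  have hμ₁ := (mem_typedSupport.1 hT₁𝒯).1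
  have hμ₂ := (mem_typedSupport.1 hT₂𝒯).2.1
  have hμ₃ := (mem_typedSupport.1 hT₃𝒯).2.2.1
  rw [hI] at hμ₁ hT₁x
  rw [hJ] at hμ₂ hT₂y
  rw [hK] at hμ₃ hT₃z
  have hT₀ : (blockOfSeq (levelSeq x), blockOfSeq (levelSeq y), blockOfSeq (levelSeq z)) ∈ D.tripleSet :=
    blockTriple_mem_tripleSet R q hne hμ₁ hμ₂ hμ₃
  have hT₀p : (blockOfSeq (levelSeq x), blockOfSeq (levelSeq y), blockOfSeq (levelSeq z)) ∈
      hashPresent (2 * c) D.tripleSet ω D.B :=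
    mem_hashPresent.2 ⟨hT₀, (mem_keptX.1 hT₁x).2.1, (mem_keptY.1 hT₂y).2.1, (mem_keptZ.1 hT₃z).2⟩
  -- `T₁ = T₀ = T₂` by the uniqueness of hash-present triples through a kept `X`-/`Y`-block
  have e₁ : T₁.1 = (blockOfSeq (levelSeq x), blockOfSeq (levelSeq y), blockOfSeq (levelSeq z)) :=
    hashPresent_unique_of_mem_keptX hT₁x (hashPresent_of_mem_presentTriples T₁.2) hT₀p hI rfl
  have e₂ : T₂.1 = (blockOfSeq (levelSeq x), blockOfSeq (levelSeq y), blockOfSeq (levelSeq z)) :=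
    hashPresent_unique_of_mem_keptY hT₂y (hashPresent_of_mem_presentTriples T₂.2) hT₀p hJ rfl
  have h12 : T₁ = T₂ := Subtype.ext (e₁.trans e₂.symm)
  -- `T₃ = T₀` by Claim 5.9: `K̂` is compatible with `T₀`, which is present (`= T₁`)
  have huX' : IsUsefulFor D.γX (chunkLevels (levelSeq x)) (chunkLevels (levelSeq y)) (chunkLevels (levelSeq z))
      (levelSeq x) := by
    have := huX; rw [e₁] at this; simpa [chunkLevels_eq_seqVal_blockOfSeq] using this
  have huY' : IsUsefulFor D.γY (chunkLevels (levelSeq x)) (chunkLevels (levelSeq y)) (chunkLevels (levelSeq z))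
      (levelSeq y) := by
    have := huY; rw [← h12, e₁] at this; simpa [chunkLevels_eq_seqVal_blockOfSeq] using this
  have hcompat : D.Compatible (blockOfSeq (levelSeq x), blockOfSeq (levelSeq y), blockOfSeq (levelSeq z))
      (levelSeq z) := by
    refine ⟨fun i j k hij hne' => ?_, ?_⟩
    · have := compatible_fst_of_useful R q hD.revX hD.revY hne huX' huY' i j k hij
        (by simpa [chunkLevels_eq_seqVal_blockOfSeq] using hne')
      simpa [chunkLevels_eq_seqVal_blockOfSeq] using this
    · -- typicality: `K̂` is useful for the `α`-consistent present triple `T₃` through `Z_K`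
      have hg₃ := present_good hD T₃.2
      have htyp := IsUsefulFor.isTypical hg₃.1 hg₃.2 huZ
      rw [hK] at htyp
      exact htyp
  have e₃ : (blockOfSeq (levelSeq x), blockOfSeq (levelSeq y), blockOfSeq (levelSeq z)) = T₃.1 :=
    huniq _ (e₁ ▸ T₁.2) rfl hcompat
  exact ⟨h12, Subtype.ext (e₂.trans e₃)⟩

/-! ### The tensor is the direct sum of its restrictions to the present triples -/

/-- The kept parts of the assignment are the kept level-1 blocks. [folklore] -/
theorem keptParts_assignX (ω : VxxzSeed M n) : keptParts (D.assignX ω) = univ.filter (D.keepX ω) := by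
  classical
  ext Ih
  rw [mem_keptParts, mem_filter]
  simp only [mem_univ, true_and, assignX]
  split_ifs with h <;> simp [h]

/-- The kept parts of the assignment are the kept level-1 blocks. [folklore] -/
theorem keptParts_assignY (ω : VxxzSeed M n) : keptParts (D.assignY ω) = univ.filter (D.keepY ω) := by
  classical
  ext Jh
  rw [mem_keptParts, mem_filter]
  simp only [mem_univ, true_and, assignY]
  split_ifs with h <;> simp [h]

/-- The kept parts of the assignment are the kept level-1 blocks. [folklore] -/
theorem keptParts_assignZ (ω : VxxzSeed M n) : keptParts (D.assignZ ω) = univ.filter (D.keepZ ω) := by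
  classical
  ext Kh
  rw [mem_keptParts, mem_filter]
  simp only [mem_univ, true_and, assignZ]
  split_ifs with h <;> simp [h]

variable (D)

/-- **The summand of the final tensor over the present triple `T`**: the sub-tensor of the power over
the level-1 blocks assigned to `T`. [cite: VassilevskaWilliamsXuXuZhou2024, §5.5 (the subtensor over X_I Y_J Z_K)] -/
def summand (R : Type u) [CommSemiring R] (q : ℕ) (ω : VxxzSeed M n) (T : ↥(D.present ω)) :
    (Fin n → Fin c → Fin (q + 2)) → (Fin n → Fin c → Fin (q + 2)) → (Fin n → Fin c → Fin (q + 2)) → R :=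
  partSubtensor levelSeq levelSeq levelSeq (kroneckerPow (kroneckerPow (bigCwTensor R q) c) n)
    (assignedParts (D.assignX ω) T) (assignedParts (D.assignY ω) T) (assignedParts (D.assignZ ω) T)

variable {D}

/-- The final tensor as the kept tensor of the assignment. [folklore] -/
theorem finalTensor_eq (R : Type u) [CommSemiring R] (q : ℕ) (ω : VxxzSeed M n) :
    D.finalTensor R q ω = partSubtensor levelSeq levelSeq levelSeq
      (kroneckerPow (kroneckerPow (bigCwTensor R q) c) n)
      (keptParts (D.assignX ω)) (keptParts (D.assignY ω)) (keptParts (D.assignZ ω)) := by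
  classical
  rw [keptParts_assignX, keptParts_assignY, keptParts_assignZ, finalTensor]

/-- **`𝒯''' ≥ ⊕_{T present} (summand T)`.** [cite: VassilevskaWilliamsXuXuZhou2024, §5.5 (the displayed direct-sum decomposition)] -/
theorem finalTensor_restrictsTo_directSum (hD : D.WellFormed) (R : Type u) [CommSemiring R] (q : ℕ)
    (ω : VxxzSeed M n) :
    TensorRestrictsTo (D.finalTensor R q ω) (familyDirectSum fun T : ↥(D.present ω) => D.summand R q ω T) := by
  rw [finalTensor_eq]
  exact partSubtensor_kept_restrictsTo_familyDirectSum _ (respectsAssignment hD R q ω)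

/-- **`⊕_{T present} (summand T) ≥ 𝒯'''`** (so the two are isomorphic). [cite: VassilevskaWilliamsXuXuZhou2024, §5.5] -/
theorem directSum_restrictsTo_finalTensor (hD : D.WellFormed) (R : Type u) [CommSemiring R] (q : ℕ)
    (ω : VxxzSeed M n) :
    TensorRestrictsTo (familyDirectSum fun T : ↥(D.present ω) => D.summand R q ω T) (D.finalTensor R q ω) := by
  rw [finalTensor_eq]
  exact familyDirectSum_restrictsTo_partSubtensor_kept _ (respectsAssignment hD R q ω)

/-! ### Claim 5.11: each summand is a broken copy of `𝒯*` with holes in the `Z`-dimension -/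

/-- The `X`-parts assigned to `T`: the level-1 `X`-sequences in `X_I` useful for `T`. [cite: VassilevskaWilliamsXuXuZhou2024, Claim 5.11 (proof)] -/
theorem assignedParts_assignX {ω : VxxzSeed M n} (T : ↥(D.present ω)) :
    assignedParts (D.assignX ω) T = univ.filter fun Ih => blockOfSeq Ih = T.1.1 ∧ D.UsefulX T.1 Ih := by
  classical
  ext Ih
  rw [mem_assignedParts, assignX_eq_some_iff, mem_filter]
  simp only [mem_univ, true_and]
  exact ⟨fun h => ⟨h.1.symm, h.2⟩, fun h => ⟨h.1.symm, h.2⟩⟩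

/-- The `Y`-parts assigned to `T`. [cite: VassilevskaWilliamsXuXuZhou2024, Claim 5.11 (proof)] -/
theorem assignedParts_assignY {ω : VxxzSeed M n} (T : ↥(D.present ω)) :
    assignedParts (D.assignY ω) T = univ.filter fun Jh => blockOfSeq Jh = T.1.2.1 ∧ D.UsefulY T.1 Jh := by
  classical
  ext Jh
  rw [mem_assignedParts, assignY_eq_some_iff, mem_filter]
  simp only [mem_univ, true_and]
  exact ⟨fun h => ⟨h.1.symm, h.2⟩, fun h => ⟨h.1.symm, h.2⟩⟩

/-- The `Z`-parts assigned to `T`: useful for `T` and NOT a hole. [cite: VassilevskaWilliamsXuXuZhou2024, Claim 5.11] -/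
theorem assignedParts_assignZ (hD : D.WellFormed) {ω : VxxzSeed M n} (T : ↥(D.present ω)) :
    assignedParts (D.assignZ ω) T =
      (univ.filter fun Kh => blockOfSeq Kh = T.1.2.2 ∧ D.UsefulZ T.1 Kh) \ D.holes ω T.1 := by
  classical
  ext Kh
  rw [mem_assignedParts, assignZ_eq_some_iff hD, mem_sdiff, mem_filter, holes, mem_filter]
  simp only [mem_univ, true_and]
  constructor
  · rintro ⟨h1, hu, huniq⟩
    refine ⟨⟨h1.symm, hu⟩, ?_⟩
    rintro ⟨-, -, T', hT', hne, h2, hc⟩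
    exact hne (huniq T' hT' (h2.trans h1) hc)
  · rintro ⟨⟨h1, hu⟩, hnot⟩
    refine ⟨h1.symm, hu, fun T' hT' h2 hc => ?_⟩
    by_contra hne
    exact hnot ⟨h1, hu, T', hT', hne, h2.trans h1, hc⟩

/-- **VXXZ Claim 5.11**: the summand of the final tensor over a present triple `T = X_I Y_J Z_K` is
the useful sub-tensor `𝒯*_T` over it (`usefulSubtensor`, the level-`ℓ` interface tensor `𝒯*` read
on the chunks of `T`, `usefulSubtensor_eq_interfaceTensor`) with the holes `holes T` — the level-1
`Z`-blocks useful for `T` but compatible with another present triple through `Z_K` — zeroed out: a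
broken copy of `𝒯*` with holes in the `Z`-dimension only.
[cite: VassilevskaWilliamsXuXuZhou2024, Claim 5.11] -/
theorem summand_eq_brokenCopy (hD : D.WellFormed) (R : Type u) [CommSemiring R] (q : ℕ) {ω : VxxzSeed M n}
    (T : ↥(D.present ω)) :
    D.summand R q ω T = partSubtensor levelSeq levelSeq levelSeq
      (usefulSubtensor R q (seqVal T.1.1) (seqVal T.1.2.1) (seqVal T.1.2.2) D.γX D.γY D.γZ)
      univ univ (D.holes ω T.1)ᶜ := by
  classical
  rw [summand, usefulSubtensor, partSubtensor_partSubtensor, assignedParts_assignX, assignedParts_assignY,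
    assignedParts_assignZ hD]
  congr 1
  · ext Ih
    simp only [mem_filter, mem_univ, true_and, mem_inter, and_true, chunkLevels_eq_iff]
  · ext Jh
    simp only [mem_filter, mem_univ, true_and, mem_inter, and_true, chunkLevels_eq_iff]
  · ext Kh
    simp only [mem_sdiff, mem_filter, mem_univ, true_and, mem_inter, mem_compl, chunkLevels_eq_iff]

end GlobalStageData

end Literature.Computability.AlgebraicComplexity
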